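import Literature.AlgebraicGeometry.AbelianSchemes.PELTupleSpreadStageOfStageDuals   -- ★ (mine) GSPREAD-CORE under the stage-duals hypothesis, iso-base ∕ localised ∕ pointwise readings
import Literature.AlgebraicGeometry.Limits.LocalizationRelativeGeomConnectedSpread        -- ★ `isLocallyNoetherian_tensorObj_baseDiagram_left`
import HarnessLib

/-!
# GSPREAD-CORE over a number field: one stage tuple, read at almost every prime `w` through `Spec 𝒪_{F,(w)} → D(s)`

The number-field packaging of ★ `exists_stage_pelTuple_of_generic_of_iso_base_pointwise_of_stageDuals` in the currency of the closer leaf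
`RecordESpreadCofinal` (crux hLiu418, road (S♭)): `𝓜` an integral model over `𝒪_F` of a proper `X ∕ F` (`𝓜.genericIso : 𝓜.total ×_{𝒪_F} F ≅ X`)
with quasi-compact, quasi-separated, locally finitely presented, separated structure map and reduced, locally Noetherian generic fibre; an
`𝒪`-PEL tuple `(A₁, ι₁, (Â₁, 𝒫₁), λ₁, φ₁)` over `X` of relative dimension `g` (level `N ≠ 0`); the stage-duals hypothesis.  THEN there are ONE stage
tuple `(s, 𝒜, ι, (Â, 𝒫), λ, φ)` over `𝓜.total ⊗ D(s)` (relative dimension `g`, flat stage) and a FINITE set `S` of primes such that every `w ∉ S`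
reaches the stage by some `τ : Spec 𝒪_{F,(w)} → D(s)` over `Spec 𝒪_F` (★ `eventually_nonempty_hom_specOver_valuationSubringAtPrime_baseDiagram`), and
for every `κ : Spec F → Spec 𝒪_{F,(w)}` over `Spec 𝒪_F` and every `t : T′ → X` the tuples
`((𝒜, …) ×_{𝓜.total ⊗ D(s)} (𝓜.total ⊗ Spec 𝒪_{F,(w)})) ×_{(genericIso⁻¹ ≫ 𝓜.total ◁ κ)} X ×_X T′` and `(A₁, …) ×_X T′` are isomorphic as tuples (six
clauses along `𝟙 T′`) — with `(𝓜.localise w).total = 𝓜.total ⊗ Spec 𝒪_{F,(w)}` and `genIncl = genericIso⁻¹ ≫ (𝓜.total ◁ κ_w)` (★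
`genericIso'_inv_left_comp_fst`) these are the `gen_iso` clauses of the spread `T_w :=` «the stage tuple base-changed along `𝓜.total ◁ τ`».

## What existed / was missing / was proved
* existed (★): `exists_stage_pelTuple_of_generic_of_iso_base_pointwise_of_stageDuals`, `IntegralModel.isProper_snd_specOver`,
  `isLocallyNoetherian_tensorObj_baseDiagram_left`, `eventually_nonempty_hom_specOver_valuationSubringAtPrime_baseDiagram`.
* missing, proved here (sorry-free): the head `IntegralModel.exists_stage_pelTuple_cofinite_of_stageDuals` (the identification of underlying schemes
  is `((Over.forget _).mapIso 𝓜.genericIso).symm`, whose `hom` is `𝓜.genericIso.inv.left` by `rfl`).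
-/

set_option autoImplicit false

noncomputable section

-- Mathlib's `Over`/pull-back API is stated across semireducible wrappers (as in the ★ `AbelianSchemes/*` files).
set_option backward.isDefEq.respectTransparency false

open CategoryTheory CategoryTheory.Limits AlgebraicGeometry MonoidalCategory IsDedekindDomain
open Literature.AlgebraicGeometry.Limits Literature.AlgebraicGeometry.Limits.LocApprox
open Literature.AlgebraicGeometry.AbelianSchemes Literature.AlgebraicGeometry.AbelianSchemes.AbelianSchemeOver
open scoped NumberField

namespace Literature.AlgebraicGeometry.Motives

namespace IntegralModel


section NumberField

variable {F : Type} [Field F] [NumberField F] {X : SchemeOver F} (𝓜 : IntegralModel (𝓞 F) F X)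
  [QuasiCompact 𝓜.total.hom] [QuasiSeparated 𝓜.total.hom] [LocallyOfFinitePresentation 𝓜.total.hom] [IsSeparated 𝓜.total.hom]
  [IsProper X.hom] [IsLocallyNoetherian (𝓜.total ⊗ specOver (𝓞 F) F).left] [IsReduced (𝓜.total ⊗ specOver (𝓞 F) F).left]

/-- **GSPREAD-CORE OVER A NUMBER FIELD, COFINITELY IN `w`** (the `∃ S_t finite, ∀ w ∉ S_t, ∃ τ, …` shape of the closer leaf's `RecordESpreadCofinal`,
chain steps (1)–(7) + the cofinite reachability of the stage).  See the module docstring. [cite: EGAIV3, Thm. 8.8.2, (8.8.2.5) and Thm. 8.10.5]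
[cite: MumfordFogartyKirwan1994, Ch. 7 §2 Definition 7.2 (p. 129) and §3 Proposition 7.3 (pp. 133–134)] [cite: Kottwitz1992, §5 (pp. 389–391)] [cite: SerreTate1968, §1] -/
theorem exists_stage_pelTuple_cofinite_of_stageDuals {O : Type*} [CommRing O] {m : ℕ} (bs : Module.Basis (Fin m) ℤ O) {g N : ℕ} [NeZero N]
    (A₁ : AbelianSchemeOver X.left) (ρ₁ : RingAction O A₁) (D₁ : A₁.DualPair) (pol₁ : A₁.Polarization D₁)
    (φ₁ : A₁.LevelStructure g N) (hg : A₁.IsOfRelDim g)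
    (hdual : ∀ (t : Idx (nonZeroDivisors (𝓞 F))) (𝒜ₜ : AbelianSchemeOver (𝓜.total ⊗ (baseDiagram (nonZeroDivisors (𝓞 F))).obj t).left)
      (G : A₁.X.left ⟶ 𝒜ₜ.X.left),
      A₁.IsBaseChangeVia 𝒜ₜ (𝓜.genericIso.inv.left ≫ (𝓜.total ◁ (baseCone (nonZeroDivisors (𝓞 F)) F).π.app t).left) G →
      ∃ (s : Idx (nonZeroDivisors (𝓞 F))) (σ : s ⟶ t), Nonempty (𝒜ₜ.baseChange (stageOver (nonZeroDivisors (𝓞 F)) 𝓜.total σ).hom).DualPair) :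
    ∃ (s : Idx (nonZeroDivisors (𝓞 F))) (𝒜 : AbelianSchemeOver (𝓜.total ⊗ (baseDiagram (nonZeroDivisors (𝓞 F))).obj s).left)
      (ρ : RingAction O 𝒜) (D : 𝒜.DualPair) (pol : 𝒜.Polarization D) (φ : 𝒜.LevelStructure g N),
      𝒜.IsOfRelDim g ∧ Flat (pullback.snd 𝓜.total.hom ((baseDiagram (nonZeroDivisors (𝓞 F))).obj s).hom) ∧
      ∃ S : Set (HeightOneSpectrum (𝓞 F)), S.Finite ∧ ∀ w : HeightOneSpectrum (𝓞 F), w ∉ S →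
        ∃ τ : specOver (𝓞 F) (HeightOneSpectrum.valuationSubringAtPrime F w) ⟶ (baseDiagram (nonZeroDivisors (𝓞 F))).obj s,
        ∀ (κ : specOver (𝓞 F) F ⟶ specOver (𝓞 F) (HeightOneSpectrum.valuationSubringAtPrime F w)) {T' : Scheme.{0}} (t : T' ⟶ X.left),
    ∃ (H : ((((𝒜.baseChange (𝓜.total ◁ τ).left).baseChange (𝓜.genericIso.inv.left ≫ (𝓜.total ◁ κ).left)).baseChange t)).X.left ⟶ (A₁.baseChange t).X.left)
              (Ĥ : (((D.baseChange (𝓜.total ◁ τ).left).baseChange (𝓜.genericIso.inv.left ≫ (𝓜.total ◁ κ).left)).baseChange t).hat.X.left ⟶ (D₁.baseChange t).hat.X.left),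
              (((φ.baseChange (𝓜.total ◁ τ).left).baseChange (𝓜.genericIso.inv.left ≫ (𝓜.total ◁ κ).left)).baseChange t).IsBaseChangeVia (φ₁.baseChange t) (𝟙 T') H ∧
              (((D.baseChange (𝓜.total ◁ τ).left).baseChange (𝓜.genericIso.inv.left ≫ (𝓜.total ◁ κ).left)).baseChange t).hat.IsBaseChangeVia (D₁.baseChange t).hat (𝟙 T') Ĥ ∧
              (∃ (wG : (((𝒜.baseChange (𝓜.total ◁ τ).left).baseChange (𝓜.genericIso.inv.left ≫ (𝓜.total ◁ κ).left)).baseChange t).X.hom ≫ 𝟙 T' =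
                    H ≫ (A₁.baseChange t).X.hom)
                  (wĜ : (((D.baseChange (𝓜.total ◁ τ).left).baseChange (𝓜.genericIso.inv.left ≫ (𝓜.total ◁ κ).left)).baseChange t).hat.X.hom ≫ 𝟙 T' =
                    Ĥ ≫ (D₁.baseChange t).hat.X.hom),
                Nonempty ((Scheme.Modules.pullback
                  (pullback.map (((𝒜.baseChange (𝓜.total ◁ τ).left).baseChange (𝓜.genericIso.inv.left ≫ (𝓜.total ◁ κ).left)).baseChange t).X.hom
                    (((D.baseChange (𝓜.total ◁ τ).left).baseChange (𝓜.genericIso.inv.left ≫ (𝓜.total ◁ κ).left)).baseChange t).hat.X.hom (A₁.baseChange t).X.hom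
                    (D₁.baseChange t).hat.X.hom H Ĥ (𝟙 T') wG wĜ)).obj (D₁.baseChange t).P ≅
                  (((D.baseChange (𝓜.total ◁ τ).left).baseChange (𝓜.genericIso.inv.left ≫ (𝓜.total ◁ κ).left)).baseChange t).P)) ∧
              (((pol.baseChange (𝓜.total ◁ τ).left).baseChange (𝓜.genericIso.inv.left ≫ (𝓜.total ◁ κ).left)).baseChange t).lam.left ≫ Ĥ = H ≫ (pol₁.baseChange t).lam.left ∧
              ∀ a : O, (AbelianSchemeOver.baseChangeHom (AbelianSchemeOver.baseChangeHom ((ρ.baseChange (𝓜.total ◁ τ).left).i a) (𝓜.genericIso.inv.left ≫ (𝓜.total ◁ κ).left)) t).left ≫ H =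
                H ≫ (AbelianSchemeOver.baseChangeHom (ρ₁.i a) t).left  := by
  classical
  haveI : ∀ s : Idx (nonZeroDivisors (𝓞 F)), IsLocallyNoetherian (𝓜.total ⊗ (baseDiagram (nonZeroDivisors (𝓞 F))).obj s).left :=
    fun s => isLocallyNoetherian_tensorObj_baseDiagram_left 𝓜.total s
  have hN : IsUnit ((N : ℕ) : F) := (Nat.cast_ne_zero.mpr (NeZero.ne N)).isUnit
  obtain ⟨s, 𝒜, ρ, D, pol, φ, hg', hfl, hpt⟩ := exists_stage_pelTuple_of_generic_of_iso_base_pointwise_of_stageDuals F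
    𝓜.isProper_snd_specOver bs hN ((Over.forget _).mapIso 𝓜.genericIso).symm A₁ ρ₁ D₁ pol₁ φ₁ hg hdual
  refine ⟨s, 𝒜, ρ, D, pol, φ, hg', hfl,
    {w | ¬ Nonempty (specOver (𝓞 F) (HeightOneSpectrum.valuationSubringAtPrime F w) ⟶ (baseDiagram (nonZeroDivisors (𝓞 F))).obj s)},
    (Literature.AlgebraicGeometry.AbelianSchemes.eventually_nonempty_hom_specOver_valuationSubringAtPrime_baseDiagram s), fun w hw => ?_⟩
  obtain ⟨τ⟩ := not_not.mp hw
  exact ⟨τ, fun κ {T'} t => hpt τ κ t⟩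

end NumberField

end IntegralModel

end Literature.AlgebraicGeometry.Motives
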